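import Summits.ResolutionOfSingularities.ResolutionOfSingularities.Theorems.PurelyInseparableDim4ChartZigzagStep
import Summits.ResolutionOfSingularities.ResolutionOfSingularities.Theorems.PurelyInseparableDim4JointStep
import Summits.ResolutionOfSingularities.ResolutionOfSingularities.Theorems.PurelyInseparableDim4PointTransport
import HarnessLib

/-!
# Purely inseparable four-folds: the COORDINATE STEP through a ZIGZAG chart — cover, hit and the new point charts
# (brick S3 (c) «joint point∘coordinate chains», part 6, cell `res-dim4-pi`; consumes typ-2 g3's (3a)/(3b))

[OURS · counted 0] (D-0157 DOOR 2; desk WORD #66 (4)(c), #74 (g); frame `PIDim4.TerminationImpliesOrderReduction`,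
S3 (c); host item stmt-ResolutionOfSingularities-16155, helper). Nothing here proves resolution of singularities in
dimension ≥ 4 / characteristic `p` — NOT here, not anywhere in this programme.

A coordinate MEMBER of a joint configuration on `(Z, M)` is seen through a ZIGZAG chart `Z ←φ— Y —ψ→ 𝔸⁵_K`
(`M.ideal.comap φ = (hypSheaf p s.F).comap ψ`) with centre ideal `Zc` reading the coordinate ideal
(`Zc.comap φ = (𝓘Λ S).comap ψ`, the interface of typ-2 g3's `exists_iso_restrict_blowup_zigzag`, p-id of
`…ChartZigzagStep`). For ANY blowing up `π : W → Z` along `Zc` this file proves what the joint tree needs at the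
closed order-`p` points OVER the member — the zigzag analogue of part 1's `coord_step_package` and of typ-3 g2's
`zigzag_step_package`:

* §1 **`finite_closedOver_model_coord_of_finite_pairs`** — on the MODEL (`B` any blowing up of `𝔸⁵_K` along
  `V(z, x_S)`): finitely many equimultiple pairs `(j, b)` ⇒ finitely many closed order-`p` points over `V(z, x_S)`;
* §2 **`exists_coordTransport_of_zigzag`** — the TRANSPORT `w ↦ ι(ε w)` from the points of `W` over
  `φ(ψ⁻¹V(z, x_S))` to the model blow-up: injective, lands over `V(z, x_S)`, closed ↦ closed (Jacobson), orders of
  the transforms preserved (typ-2's `ε` + flat base change); **`finite_closedOver_zigzag_coord_of_finite_pairs`** —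
  hence finite branching over a coordinate member from finitely many equimultiple pairs;
* §3 **`coord_zigzag_step_package`** — COVER + HIT + CHART: every CLOSED `w ∈ W` over the member with
  `ord_w (M.transform π Zc) ≥ p` comes from an EDGE `Edge p S s (step p S j b s)` (`j ∈ S`, `b_j = 0`, `(j, b)`
  equimultiple) and carries a zigzag chart `W ←φ″— Y″ —ψ″→ 𝔸⁵` with `φ″ y″ = w`, `ψ″ y″ = ξ`,
  `(M.transform π Zc).ideal.comap φ″ = (hypSheaf p (step p S j b s).F).comap ψ″` — the point regime's member format
  (`…PointTreeLocal`) for the new stage (typ-2's `zigzag_transport_comap` on the model chart of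
  `controlledTransform_chart_eq_step`, which HITS `w` by part 1's `specMap_ξ_eq_of_reading`).

AI-produced formalisation, weaker than expert review. bears_on: LADDER-RESOLUTION:D157-DOOR2 (res-dim4-pi · S3 (c) joint).
-/

set_option linter.dupNamespace false -- D-0017: single-problem summit path `Summit.<S>.<S>.…` by design

noncomputable section

open MvPolynomial Finset CategoryTheory AlgebraicGeometry Opposite TopologicalSpace
open AlgebraicGeometry.Scheme.IdealSheafData (ofIdealTop vanishingIdeal)

namespace Summit.ResolutionOfSingularities.ResolutionOfSingularities.Theorems.PIDim4

open Literature.AlgebraicGeometry.Resolution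
open Literature.AlgebraicGeometry.Resolution.Hauser2010
open Literature.AlgebraicGeometry.Resolution.AffinePointBlowup (P A γ coord Wtop ξ)

namespace Equimultiple

/-! ## §1 Finite branching on the model -/

section ModelFinite

variable {K : Type} [Field K] {p : ℕ} [hp : Fact p.Prime] [CharP K p]
variable {Bl : Scheme.{0}} {B : Bl ⟶ P 4 K} {S : Finset (Fin 4)}

/-- **FINITE BRANCHING ON THE MODEL.** `K = K̄`, `B : Bl → 𝔸⁵_K` any blowing up along `V(z, x_S)`, `p ≤ ord_{(x_S)} s.F`.
If only finitely many pairs `(j, b)` (`j ∈ S`, `b_j = 0`) are equimultiple at `s`, then the controlled transform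
`Bᶜ((z^p + s.F)·𝒪, p)` has only finitely many closed points of order `≥ p` over `V(z, x_S)`.
[cite: Hauser2010, §F (equiconstant points)] [cite: BierstoneGrigorievMilmanWlodarczyk2011, §3.2 and Lemma 8.0.3 (2)] -/
theorem finite_closedOver_model_coord_of_finite_pairs [IsAlgClosed K] (s : State K)
    (hperm : (p : ℕ∞) ≤ CentreBlowup.ordAlong S s.F)
    (hB : IsBlowup B (AffineCoordBlowup.𝓘Λ 4 K (insert 0 (Fin.succ '' (S : Set (Fin 4))))))
    (hfin : {jb : Fin 4 × (Fin 4 → K) | jb.1 ∈ S ∧ jb.2 jb.1 = 0 ∧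
      CentreBlowup.IsEquimultiplePoint p S jb.1 jb.2 s}.Finite) :
    {w : Bl | IsClosed ({w} : Set Bl) ∧
      B w ∈ AffineCoordBlowup.CΛ 4 K (insert 0 (Fin.succ '' (S : Set (Fin 4)))) ∧
      (p : ℕ∞) ≤ idealOrder (controlledTransform B
        (AffineCoordBlowup.𝓘Λ 4 K (insert 0 (Fin.succ '' (S : Set (Fin 4))))) (hypSheaf p s.F) p) w}.Finite := by
  classical
  have cover : ∀ w : Bl, IsClosed ({w} : Set Bl) →
      B w ∈ AffineCoordBlowup.CΛ 4 K (insert 0 (Fin.succ '' (S : Set (Fin 4)))) →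
      (p : ℕ∞) ≤ idealOrder (controlledTransform B
        (AffineCoordBlowup.𝓘Λ 4 K (insert 0 (Fin.succ '' (S : Set (Fin 4))))) (hypSheaf p s.F) p) w →
      ∃ jb : Fin 4 × (Fin 4 → K), ∃ (hj : jb.1 ∈ S) (x : P 4 K) (a : K),
        AffineCoordBlowup.chartImm hB (ChartDictionary.succ_mem_centreVars hj) x = w ∧
          x.asIdeal = MvPolynomial.vanishingIdeal K {(Fin.cons a jb.2 : Fin (4 + 1) → K)} ∧
            a ^ p + MvPolynomial.eval jb.2 (CentreBlowup.chartTransform p S jb.1 s.F) = 0 ∧ jb.2 jb.1 = 0 ∧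
              CentreBlowup.IsEquimultiplePoint p S jb.1 jb.2 s := by
    intro w hw hwC hord
    obtain ⟨j, hj, x, a, b, hxw, hx, hab, heq⟩ :=
      (le_idealOrder_controlledTransform_iff_exists_chart s hperm hB hw).mp hord
    have hbj : b j = 0 := by
      rw [← X_succ_mem_asIdeal_iff j a b hx, ← π_chartImm_mem_CΛ_iff hB hj x, hxw]
      exact hwC
    exact ⟨(j, b), hj, x, a, hxw, hx, hab, hbj, heq⟩
  let g : Bl → Fin 4 × (Fin 4 → K) := fun w =>
    if hc : IsClosed ({w} : Set Bl) ∧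
        B w ∈ AffineCoordBlowup.CΛ 4 K (insert 0 (Fin.succ '' (S : Set (Fin 4)))) ∧
        (p : ℕ∞) ≤ idealOrder (controlledTransform B
          (AffineCoordBlowup.𝓘Λ 4 K (insert 0 (Fin.succ '' (S : Set (Fin 4))))) (hypSheaf p s.F) p) w
    then (cover w hc.1 hc.2.1 hc.2.2).choose else ((0 : Fin 4), (0 : Fin 4 → K))
  refine Set.Finite.of_finite_image (f := g) (hfin.subset ?_) ?_
  · rintro _ ⟨w, hw, rfl⟩
    have hg : g w = (cover w hw.1 hw.2.1 hw.2.2).choose := dif_pos hw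
    obtain ⟨hj, x, a, -, -, -, hbj, heq⟩ := (cover w hw.1 hw.2.1 hw.2.2).choose_spec
    rw [hg]
    exact ⟨hj, hbj, heq⟩
  · intro w hw w' hw' hgg
    have hg : g w = (cover w hw.1 hw.2.1 hw.2.2).choose := dif_pos hw
    have hg' : g w' = (cover w' hw'.1 hw'.2.1 hw'.2.2).choose := dif_pos hw'
    have key : ∀ jb jb' : Fin 4 × (Fin 4 → K), jb = jb' →
        (∃ (hj : jb.1 ∈ S) (x : P 4 K) (a : K),
          AffineCoordBlowup.chartImm hB (ChartDictionary.succ_mem_centreVars hj) x = w ∧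
            x.asIdeal = MvPolynomial.vanishingIdeal K {(Fin.cons a jb.2 : Fin (4 + 1) → K)} ∧
              a ^ p + MvPolynomial.eval jb.2 (CentreBlowup.chartTransform p S jb.1 s.F) = 0 ∧ jb.2 jb.1 = 0 ∧
                CentreBlowup.IsEquimultiplePoint p S jb.1 jb.2 s) →
        (∃ (hj : jb'.1 ∈ S) (x : P 4 K) (a : K),
          AffineCoordBlowup.chartImm hB (ChartDictionary.succ_mem_centreVars hj) x = w' ∧
            x.asIdeal = MvPolynomial.vanishingIdeal K {(Fin.cons a jb'.2 : Fin (4 + 1) → K)} ∧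
              a ^ p + MvPolynomial.eval jb'.2 (CentreBlowup.chartTransform p S jb'.1 s.F) = 0 ∧ jb'.2 jb'.1 = 0 ∧
                CentreBlowup.IsEquimultiplePoint p S jb'.1 jb'.2 s) →
        w = w' := by
      rintro jb _ rfl ⟨hj, x, a, hxw, hx, hab, -, -⟩ ⟨hj', x', a', hxw', hx', hab', -, -⟩
      have haa : a = a' := by
        apply frobenius_inj K p
        rw [frobenius_def, frobenius_def, eq_neg_of_add_eq_zero_left hab, eq_neg_of_add_eq_zero_left hab']
      have hxx : x = x' := by
        apply PrimeSpectrum.ext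
        rw [hx, hx', haa]
      rw [← hxw, ← hxw', hxx]
    exact key _ _ (hg.symm.trans (hgg.trans hg')) (cover w hw.1 hw.2.1 hw.2.2).choose_spec
      (cover w' hw'.1 hw'.2.1 hw'.2.2).choose_spec

end ModelFinite

/-! ## §2 Transport from the member to the model -/

section Transport

variable {K : Type} [Field K] {p : ℕ} [hp : Fact p.Prime] [CharP K p]
variable {Z Y W Bl : Scheme.{0}} (φ : Y ⟶ Z) [IsOpenImmersion φ] (ψ : Y ⟶ P 4 K) [IsOpenImmersion ψ]
  {π : W ⟶ Z} {B : Bl ⟶ P 4 K} {S : Finset (Fin 4)}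

omit hp [CharP K p] in
/-- **COORDINATE TRANSPORT.** For a zigzag chart `Z ←φ— Y —ψ→ 𝔸⁵` with `M.ideal.comap φ = (hypSheaf p s.F).comap ψ`,
a centre `Zc` reading `(𝓘Λ S).comap ψ` on the chart, `π : W → Z` ANY blowing up along `Zc` and `B` ANY blowing up of
`𝔸⁵_K` along `V(z, x_S)`: there is an INJECTIVE map `f` from the points of `W` over `φ(ψ⁻¹V(z, x_S))` to `Bl`, landing
over `V(z, x_S)`, carrying closed points to closed points, and preserving the orders of the transformed ideals (typ-2
g3's comparison isomorphism `ε : π⁻¹φ(Y) ≅ B⁻¹ψ(Y)`). [cite: GortzWedhorn2020, Prop. 13.91]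
[cite: BierstoneGrigorievMilmanWlodarczyk2011, §3.2 with Thm. 8.0.5] -/
theorem exists_coordTransport_of_zigzag [IsLocallyNoetherian Z] (Zc : Z.IdealSheafData)
    (hZφ : Zc.comap φ = (AffineCoordBlowup.𝓘Λ 4 K (insert 0 (Fin.succ '' (S : Set (Fin 4))))).comap ψ)
    (hπ : IsBlowup π Zc) (hB : IsBlowup B (AffineCoordBlowup.𝓘Λ 4 K (insert 0 (Fin.succ '' (S : Set (Fin 4))))))
    (M : MarkedIdeal Z) (hmult : M.mult = p) (s : State K) (hM : M.ideal.comap φ = (hypSheaf p s.F).comap ψ) :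
    ∃ f : {w : W // π w ∈ φ '' (ψ ⁻¹'
        (AffineCoordBlowup.CΛ 4 K (insert 0 (Fin.succ '' (S : Set (Fin 4)))) : Set (P 4 K)))} → Bl,
      Function.Injective f ∧ ∀ w,
        B (f w) ∈ AffineCoordBlowup.CΛ 4 K (insert 0 (Fin.succ '' (S : Set (Fin 4)))) ∧
        (IsClosed ({w.1} : Set W) → IsClosed ({f w} : Set Bl)) ∧
        idealOrder (controlledTransform B (AffineCoordBlowup.𝓘Λ 4 K (insert 0 (Fin.succ '' (S : Set (Fin 4)))))
            (hypSheaf p s.F) p) (f w) =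
          idealOrder (M.transform π Zc).ideal w.1 := by
  haveI : IsProper π := hπ.isProper
  haveI : IsLocallyNoetherian W := LocallyOfFiniteType.isLocallyNoetherian π
  haveI : IsProper B := hB.isProper
  haveI : IsLocallyNoetherian Bl := LocallyOfFiniteType.isLocallyNoetherian B
  haveI : JacobsonSpace Bl := jacobsonSpace_of_isBlowup' hB
  have he₁ι : φ.isoOpensRange.hom ≫ φ.opensRange.ι = φ := Scheme.Hom.isoOpensRange_hom_ι φ
  have he₂ι : ψ.isoOpensRange.hom ≫ ψ.opensRange.ι = ψ := Scheme.Hom.isoOpensRange_hom_ι ψ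
  obtain ⟨ε, hsq, -, hKEY⟩ := ChartDictionary.exists_iso_restrict_blowup_zigzag φ ψ _ Zc hZφ hπ hB
  have hK := hKEY M.ideal (hypSheaf p s.F) p hM
  have hwV : ∀ w : {w : W // π w ∈ φ '' (ψ ⁻¹'
      (AffineCoordBlowup.CΛ 4 K (insert 0 (Fin.succ '' (S : Set (Fin 4)))) : Set (P 4 K)))},
      w.1 ∈ π ⁻¹ᵁ φ.opensRange := fun w => by
    obtain ⟨y, -, hy⟩ := w.2
    exact ⟨y, hy⟩
  refine ⟨fun w => (B ⁻¹ᵁ ψ.opensRange).ι (ε.hom ⟨w.1, hwV w⟩), fun w w' hww => ?_,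
    fun w => ⟨?_, fun hwc => ?_, ?_⟩⟩
  · -- injectivity
    have h1 := (B ⁻¹ᵁ ψ.opensRange).ι.isOpenEmbedding.injective hww
    have h2 := ε.hom.isOpenEmbedding.injective h1
    exact Subtype.ext (by have h3 := Subtype.ext_iff.mp h2; exact h3)
  · -- over the centre
    obtain ⟨q, hq, hqw⟩ := w.2
    have hφinv : φ.isoOpensRange.inv ((π ∣_ φ.opensRange) ⟨w.1, hwV w⟩) = q := by
      have h1 : (π ∣_ φ.opensRange) ⟨w.1, hwV w⟩ = φ.isoOpensRange.hom q := by
        apply Subtype.ext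
        rw [morphismRestrict_base_coe]
        change π w.1 = ((φ.isoOpensRange.hom ≫ φ.opensRange.ι) q : Z)
        rw [he₁ι, hqw]
      rw [h1, ← Scheme.Hom.comp_apply, Iso.hom_inv_id]
      rfl
    change B ((B ⁻¹ᵁ ψ.opensRange).ι (ε.hom ⟨w.1, hwV w⟩)) ∈ _
    rw [← ι_morphismRestrict_apply, ← Scheme.Hom.comp_apply ε.hom (B ∣_ ψ.opensRange), hsq, Scheme.Hom.comp_apply,
      Scheme.Hom.comp_apply, hφinv, ← Scheme.Hom.comp_apply, he₂ι]
    exact hq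
  · -- closed points go to closed points
    have hwt_closed : IsClosed ({(⟨w.1, hwV w⟩ : (π ⁻¹ᵁ φ.opensRange : Scheme.{0}))} :
        Set (π ⁻¹ᵁ φ.opensRange : Scheme.{0})) :=
      isClosed_singleton_of_isOpenImmersion_eq (π ⁻¹ᵁ φ.opensRange).ι ⟨w.1, hwV w⟩ hwc rfl
    have hεwt_closed : IsClosed ({ε.hom ⟨w.1, hwV w⟩} : Set (B ⁻¹ᵁ ψ.opensRange : Scheme.{0})) := by
      have h : (ε.inv : (B ⁻¹ᵁ ψ.opensRange : Scheme.{0}) → (π ⁻¹ᵁ φ.opensRange : Scheme.{0})) ⁻¹'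
          {⟨w.1, hwV w⟩} = {ε.hom ⟨w.1, hwV w⟩} := by
        ext z
        simp only [Set.mem_preimage, Set.mem_singleton_iff]
        constructor
        · intro hz
          rw [← hz, ← Scheme.Hom.comp_apply, Iso.inv_hom_id]
          rfl
        · intro hz
          rw [hz, ← Scheme.Hom.comp_apply, Iso.hom_inv_id]
          rfl
      rw [← h]
      exact hwt_closed.preimage ε.inv.continuous
    apply isClosed_singleton_of_isLocallyClosed_singleton
    rw [← Set.image_singleton]
    exact hεwt_closed.isLocallyClosed.image (B ⁻¹ᵁ ψ.opensRange).ι.isOpenEmbedding.isInducing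
      (B ⁻¹ᵁ ψ.opensRange).ι.isOpenEmbedding.isOpen_range.isLocallyClosed
  · -- orders
    have hιwt : (π ⁻¹ᵁ φ.opensRange).ι ⟨w.1, hwV w⟩ = w.1 := rfl
    conv_rhs => rw [← hιwt, ← idealOrder_comap_of_isOpenImmersion (π ⁻¹ᵁ φ.opensRange).ι,
      MarkedIdeal.transform_ideal, hmult, ← hK, idealOrder_comap_of_isOpenImmersion ε.hom,
      idealOrder_comap_of_isOpenImmersion (B ⁻¹ᵁ ψ.opensRange).ι]

/-- **FINITE BRANCHING OVER A COORDINATE MEMBER.** In the setting of `exists_coordTransport_of_zigzag` with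
`K = K̄` and `p ≤ ord_{(x_S)} s.F`: finitely many equimultiple pairs `(j, b)` at `s` ⇒ finitely many closed points of
`W` over `φ(ψ⁻¹V(z, x_S))` at which `M.transform π Zc` has order `≥ p`. [cite: Hauser2010, §F (equiconstant points)] -/
theorem finite_closedOver_zigzag_coord_of_finite_pairs [IsLocallyNoetherian Z] [IsAlgClosed K] (Zc : Z.IdealSheafData)
    (hZφ : Zc.comap φ = (AffineCoordBlowup.𝓘Λ 4 K (insert 0 (Fin.succ '' (S : Set (Fin 4))))).comap ψ)
    (hπ : IsBlowup π Zc) (M : MarkedIdeal Z) (hmult : M.mult = p) (s : State K)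
    (hM : M.ideal.comap φ = (hypSheaf p s.F).comap ψ) (hperm : (p : ℕ∞) ≤ CentreBlowup.ordAlong S s.F)
    (hfin : {jb : Fin 4 × (Fin 4 → K) | jb.1 ∈ S ∧ jb.2 jb.1 = 0 ∧
      CentreBlowup.IsEquimultiplePoint p S jb.1 jb.2 s}.Finite) :
    {w : W | IsClosed ({w} : Set W) ∧
      π w ∈ φ '' (ψ ⁻¹' (AffineCoordBlowup.CΛ 4 K (insert 0 (Fin.succ '' (S : Set (Fin 4)))) : Set (P 4 K))) ∧
      (p : ℕ∞) ≤ idealOrder (M.transform π Zc).ideal w}.Finite := by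
  set B := blowup.π (AffineCoordBlowup.𝓘Λ 4 K (insert 0 (Fin.succ '' (S : Set (Fin 4))))) with hBdef
  have hB : IsBlowup B _ := blowup.isBlowup _
  obtain ⟨f, hf, hfw⟩ := exists_coordTransport_of_zigzag φ ψ Zc hZφ hπ hB M hmult s hM
  have hmodel := finite_closedOver_model_coord_of_finite_pairs s hperm hB hfin
  -- restrict `f` to the set in question and inject into the model's finite set
  let g : {w : W // w ∈ {w : W | IsClosed ({w} : Set W) ∧
      π w ∈ φ '' (ψ ⁻¹' (AffineCoordBlowup.CΛ 4 K (insert 0 (Fin.succ '' (S : Set (Fin 4)))) : Set (P 4 K))) ∧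
      (p : ℕ∞) ≤ idealOrder (M.transform π Zc).ideal w}} → hmodel.toFinset :=
    fun w => ⟨f ⟨w.1, w.2.2.1⟩, by
      rw [Set.Finite.mem_toFinset]
      obtain ⟨hC, hcl, hord⟩ := hfw ⟨w.1, w.2.2.1⟩
      exact ⟨hcl w.2.1, hC, by rw [hord]; exact w.2.2.2⟩⟩
  have hg : Function.Injective g := by
    intro w w' hww
    have h1 : f ⟨w.1, w.2.2.1⟩ = f ⟨w'.1, w'.2.2.1⟩ := Subtype.ext_iff.mp hww
    exact Subtype.ext (by have h3 := Subtype.ext_iff.mp (hf h1); exact h3)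
  haveI : Finite {w : W // w ∈ {w : W | IsClosed ({w} : Set W) ∧
      π w ∈ φ '' (ψ ⁻¹' (AffineCoordBlowup.CΛ 4 K (insert 0 (Fin.succ '' (S : Set (Fin 4)))) : Set (P 4 K))) ∧
      (p : ℕ∞) ≤ idealOrder (M.transform π Zc).ideal w}} := Finite.of_injective g hg
  exact Set.toFinite _

end Transport

/-! ## §3 The coordinate step through a zigzag chart: cover, hit, new point charts -/

section Package

variable {K : Type} [Field K] {p : ℕ} [hp : Fact p.Prime] [CharP K p] [DecidableEq K]
variable {Z Y W : Scheme.{0}} (φ : Y ⟶ Z) [IsOpenImmersion φ] (ψ : Y ⟶ P 4 K) [IsOpenImmersion ψ]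
  {π : W ⟶ Z} {S : Finset (Fin 4)}

/-- **THE COORDINATE STEP PACKAGE THROUGH A ZIGZAG CHART.** `Z` locally Noetherian, `K = K̄` of characteristic `p`;
a zigzag chart `Z ←φ— Y —ψ→ 𝔸⁵_K` with `M.ideal.comap φ = (hypSheaf p s.F).comap ψ`, `mult M = p`, `s.F ≠ 0` clean,
`V(z, x_S)` Hironaka-permissible; a centre `Zc` with `Zc.comap φ = (𝓘Λ S).comap ψ`; `π : W → Z` ANY blowing up along
`Zc`. Then every CLOSED `w ∈ W` over `φ(ψ⁻¹V(z, x_S))` with `ord_w (M.transform π Zc) ≥ p` comes from an EDGE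
`PIDim4.Edge p S s (step p S j b s)` (`j ∈ S`, `b_j = 0`, `(j, b)` equimultiple) and carries a zigzag chart
`W ←φ″— Y″ —ψ″→ 𝔸⁵` at `w` (`φ″ y″ = w`, `ψ″ y″ = ξ`) on which `M.transform π Zc` reads
`(z^p + (step p S j b s).F)·𝒪` — the point regime's INVARIANT at the new stage.
[cite: Hauser2010, §F (equiconstant points)] [cite: BierstoneGrigorievMilmanWlodarczyk2011, §3.2 and Lemma 8.0.3 (2)]
[cite: GortzWedhorn2020, Prop. 13.91] -/
theorem coord_zigzag_step_package [IsLocallyNoetherian Z] [IsAlgClosed K] (Zc : Z.IdealSheafData)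
    (hZφ : Zc.comap φ = (AffineCoordBlowup.𝓘Λ 4 K (insert 0 (Fin.succ '' (S : Set (Fin 4))))).comap ψ)
    (hπ : IsBlowup π Zc) (M : MarkedIdeal Z) (hmult : M.mult = p) (s : State K)
    (hM : M.ideal.comap φ = (hypSheaf p s.F).comap ψ) (hF : s.F ≠ 0)
    (hclean : Literature.Barriers.ResolutionOfSingularities.HauserPerlega.IsClean p s.F)
    (hS : IsPermissibleCentre p S s.F) {w : W} (hw : IsClosed ({w} : Set W))
    (hwx : π w ∈ φ '' (ψ ⁻¹' (AffineCoordBlowup.CΛ 4 K (insert 0 (Fin.succ '' (S : Set (Fin 4)))) : Set (P 4 K))))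
    (hord : (p : ℕ∞) ≤ idealOrder (M.transform π Zc).ideal w) :
    ∃ (j : Fin 4) (b : Fin 4 → K), j ∈ S ∧ b j = 0 ∧ Edge p S s (CentreBlowup.step p S j b s) ∧
      CentreBlowup.IsEquimultiplePoint p S j b s ∧
      ∃ (Y' : Scheme.{0}) (φ' : Y' ⟶ W) (ψ' : Y' ⟶ P 4 K) (_ : IsOpenImmersion φ') (_ : IsOpenImmersion ψ')
        (y' : Y'), φ' y' = w ∧ ψ' y' = ξ 4 K ∧
        (M.transform π Zc).ideal.comap φ' = (hypSheaf p (CentreBlowup.step p S j b s).F).comap ψ' := by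
  haveI : PerfectRing K p := PerfectRing.ofSurjective K p fun x => IsAlgClosed.exists_pow_nat_eq x hp.out.pos
  haveI : IsProper π := hπ.isProper
  haveI : IsLocallyNoetherian W := LocallyOfFiniteType.isLocallyNoetherian π
  set C₀ := AffineCoordBlowup.𝓘Λ 4 K (insert 0 (Fin.succ '' (S : Set (Fin 4)))) with hC₀
  set B := blowup.π C₀ with hBdef
  have hB : IsBlowup B C₀ := blowup.isBlowup _
  haveI : IsProper B := hB.isProper
  haveI : IsLocallyNoetherian (blowup C₀) := LocallyOfFiniteType.isLocallyNoetherian B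
  haveI : JacobsonSpace (blowup C₀) := jacobsonSpace_of_isBlowup' hB
  have he₁ι : φ.isoOpensRange.hom ≫ φ.opensRange.ι = φ := Scheme.Hom.isoOpensRange_hom_ι φ
  have he₂ι : ψ.isoOpensRange.hom ≫ ψ.opensRange.ι = ψ := Scheme.Hom.isoOpensRange_hom_ι ψ
  obtain ⟨ε, hsq, -, hKEY⟩ := ChartDictionary.exists_iso_restrict_blowup_zigzag φ ψ _ Zc hZφ hπ hB
  have hK := hKEY M.ideal (hypSheaf p s.F) p hM
  -- the transported point `w₀ = ι (ε w)` of the model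
  have hwV : w ∈ π ⁻¹ᵁ φ.opensRange := by
    obtain ⟨y, -, hy⟩ := hwx
    exact ⟨y, hy⟩
  set wt : (π ⁻¹ᵁ φ.opensRange : Scheme.{0}) := ⟨w, hwV⟩ with hwt
  set z := ε.hom wt with hz
  set w₀ : blowup C₀ := (B ⁻¹ᵁ ψ.opensRange).ι z with hw₀
  have hw₀_closed : IsClosed ({w₀} : Set (blowup C₀)) := by
    have hwt_closed : IsClosed ({wt} : Set (π ⁻¹ᵁ φ.opensRange : Scheme.{0})) :=
      isClosed_singleton_of_isOpenImmersion_eq (π ⁻¹ᵁ φ.opensRange).ι wt hw rfl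
    have hz_closed : IsClosed ({z} : Set (B ⁻¹ᵁ ψ.opensRange : Scheme.{0})) := by
      have h : (ε.inv : (B ⁻¹ᵁ ψ.opensRange : Scheme.{0}) → (π ⁻¹ᵁ φ.opensRange : Scheme.{0})) ⁻¹' {wt} =
          {z} := by
        ext z'
        simp only [Set.mem_preimage, Set.mem_singleton_iff]
        constructor
        · intro hz'
          rw [hz, ← hz', ← Scheme.Hom.comp_apply, Iso.inv_hom_id]
          rfl
        · intro hz'
          rw [hz', hz, ← Scheme.Hom.comp_apply, Iso.hom_inv_id]
          rfl
      rw [← h]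
      exact hwt_closed.preimage ε.inv.continuous
    apply isClosed_singleton_of_isLocallyClosed_singleton
    rw [← Set.image_singleton]
    exact hz_closed.isLocallyClosed.image (B ⁻¹ᵁ ψ.opensRange).ι.isOpenEmbedding.isInducing
      (B ⁻¹ᵁ ψ.opensRange).ι.isOpenEmbedding.isOpen_range.isLocallyClosed
  have hw₀C : B w₀ ∈ AffineCoordBlowup.CΛ 4 K (insert 0 (Fin.succ '' (S : Set (Fin 4)))) := by
    obtain ⟨q, hq, hqw⟩ := hwx
    have hφinv : φ.isoOpensRange.inv ((π ∣_ φ.opensRange) wt) = q := by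
      have h1 : (π ∣_ φ.opensRange) wt = φ.isoOpensRange.hom q := by
        apply Subtype.ext
        rw [morphismRestrict_base_coe]
        change π w = ((φ.isoOpensRange.hom ≫ φ.opensRange.ι) q : Z)
        rw [he₁ι, hqw]
      rw [h1, ← Scheme.Hom.comp_apply, Iso.hom_inv_id]
      rfl
    rw [hw₀, ← ι_morphismRestrict_apply, hz, ← Scheme.Hom.comp_apply ε.hom (B ∣_ ψ.opensRange), hsq,
      Scheme.Hom.comp_apply, Scheme.Hom.comp_apply, hφinv, ← Scheme.Hom.comp_apply, he₂ι]
    exact hq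
  have hord₀ : (p : ℕ∞) ≤ idealOrder (controlledTransform B C₀ (hypSheaf p s.F) p) w₀ := by
    have hιwt : (π ⁻¹ᵁ φ.opensRange).ι wt = w := rfl
    have h := hord
    rw [MarkedIdeal.transform_ideal, hmult, ← hιwt, ← idealOrder_comap_of_isOpenImmersion (π ⁻¹ᵁ φ.opensRange).ι,
      ← hK, idealOrder_comap_of_isOpenImmersion ε.hom,
      idealOrder_comap_of_isOpenImmersion (B ⁻¹ᵁ ψ.opensRange).ι] at h
    rw [hw₀, hz]
    exact h
  -- S3 (b) «POINTS» on the model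
  obtain ⟨j, hj, x, a, b, hxw, hx, hab, heq⟩ :=
    (le_idealOrder_controlledTransform_iff_exists_chart s hS.2 hB hw₀_closed).mp hord₀
  have hbj : b j = 0 := by
    rw [← X_succ_mem_asIdeal_iff j a b hx, ← π_chartImm_mem_CΛ_iff hB hj x, hxw]
    exact hw₀C
  -- the model chart at `x` (typ-2's dictionary) HITS `w₀`
  obtain ⟨Θ, h, h0, hs, hc⟩ := ChartDictionary.controlledTransform_chart_eq_step p hj hbj s hS.2 hB
  haveI := isOpenImmersion_specMap_algEquiv Θ
  have hpt := specMap_ξ_eq_of_reading hB s hS.2 hj Θ h h0 hs hc hx hab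
  set φ₀ : P 4 K ⟶ blowup C₀ := Spec.map (CommRingCat.ofHom (Θ : A 4 K →+* A 4 K)) ≫
    AffineCoordBlowup.chartImm hB (ChartDictionary.succ_mem_centreVars hj) with hφ₀
  have hφ₀ξ : φ₀ (ξ 4 K) = w₀ := by
    rw [hφ₀, Scheme.Hom.comp_apply, hpt, hxw]
  have hξY : ξ 4 K ∈ φ₀ ⁻¹ᵁ (B ⁻¹ᵁ ψ.opensRange) := by
    change φ₀ (ξ 4 K) ∈ B ⁻¹ᵁ ψ.opensRange
    rw [hφ₀ξ, hw₀]
    exact z.2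
  -- the zigzag chart of the chart at `w`
  refine ⟨j, b, hj, hbj, edge_step_of_isEquimultiplePoint s hF hclean hS hj hbj heq, heq,
    (φ₀ ⁻¹ᵁ (B ⁻¹ᵁ ψ.opensRange) : (P 4 K).Opens),
    (φ₀ ∣_ (B ⁻¹ᵁ ψ.opensRange)) ≫ ε.inv ≫ (π ⁻¹ᵁ φ.opensRange).ι, (φ₀ ⁻¹ᵁ (B ⁻¹ᵁ ψ.opensRange)).ι,
    inferInstance, inferInstance, ⟨ξ 4 K, hξY⟩, ?_, rfl, ?_⟩
  · -- `φ″ y″ = w`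
    have h1 : (φ₀ ∣_ (B ⁻¹ᵁ ψ.opensRange)) ⟨ξ 4 K, hξY⟩ = z := by
      apply Subtype.ext
      rw [morphismRestrict_base_coe]
      change φ₀ (ξ 4 K) = ((B ⁻¹ᵁ ψ.opensRange).ι z : blowup C₀)
      rw [hφ₀ξ]
    rw [Scheme.Hom.comp_apply, Scheme.Hom.comp_apply, h1, hz, ← Scheme.Hom.comp_apply ε.hom ε.inv, Iso.hom_inv_id]
    rfl
  · -- the reading
    rw [MarkedIdeal.transform_ideal, hmult, ChartDictionary.zigzag_transport_comap φ ψ ε φ₀ _ _ hK, hc]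

end Package

end Equimultiple

end Summit.ResolutionOfSingularities.ResolutionOfSingularities.Theorems.PIDim4

end
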